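import Literature.NumberTheory.Sieve.DrappeauTopacogullari
import Mathlib.NumberTheory.DirichletCharacter.Bounds
import Mathlib.NumberTheory.Harmonic.Bounds
import HarnessLib

/-!
# Drappeau–Topacogullari 2019, Theorem 1.2 at conductor one — proved bricks of the printed proof

Companion ("Proofs" sibling, theorem-only) of `Literature.NumberTheory.Sieve.DrappeauTopacogullari`,
which vendors Theorem 1.2 of S. Drappeau, B. Topacogullari, *Combinatorial identities and
Titchmarsh's divisor problem for multiplicative functions*, Algebra & Number Theory 13 (2019)
2383–2425, in the case `D = 1` as the named fact `DrappeauTopacogullari2019.thm12_conductorOne`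
(source held: `lit read arxiv-1807.09569`; Theorem 1.2 on PDF p. 4, §2.1 and Proposition 2.1 on
p. 9, §8 on p. 23).

The printed proof of Theorem 1.2 (overview §1.4, pp. 6–8; plan p. 8) is: Proposition 2.1 (the
dispersion estimate `|Σ_f(I; a, h; R)| ≤ C τ((a,h)) x (log x)^B R^{-1/3}` for the approximant
`τ̃_h(n; R)` of (2.1), proved in §§3–7 from combinatorial identities of Heath-Brown and Linnik
type, Type `d₁`/`d₂` estimates resting on Voronoi summation and the Kuznetsov formula
([T-dk], [Top17a]) and Type II estimates resting on Drappeau's dispersion estimates with the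
Deshouillers–Iwaniec bounds ([D-disp])) and Lemma 8.1 (a Siegel–Walfisz bound for `χ f`,
`f ∈ 𝓕_D(A)`), assembled in §8.  None of the deep inputs is in Mathlib or in this tree; this file
collects the elementary bricks that are, bottom-up and in the paper's order, all PROVED (no named
facts are introduced here, D-0026):

* §2.1, the divisor-pair symmetry behind (2.1) ("Note that `τ̃_h(n;R) = τ(n−h)` if `R > √(n−h)`
  and `n − h` is not a perfect square", p. 9): `two_mul_card_divisors_mul_self_le`
  (`2 · #{q ∣ m : q² ≤ m} = τ(m) + #{q ∣ m : q² = m}`), `card_divisors_filter_mul_self_eq`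
  (the correction is `[m is a nonzero square]`), and the resulting opening move of the dispersion
  method for the sum of Theorem 1.2, `shiftedSum_eq_divisorPairs`:
  `S_f(x; h, a) = 2 ∑_n f(n) · #{q ∣ an − h : q² ≤ an − h} − ∑_{an − h = □} f(n)`.
* Consumer corollaries `thm12_conductorOne.liouville`, `thm12_conductorOne.moebius`: the named
  fact specialised to `f = λ`, `f = μ` (`A = 1`; `liouville_mem_classF`, `moebius_mem_classF`),
  the `R = 1` case used by the Parity route `ShiftedMultiplicationTable`.

* §2.1 continued (the objects `dtilde = τ̃_h(n; R)`, `delta = Δ_h(n; R)`, `sigmaF = Σ_f` live in the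
  base file): `delta_eq_neg_card_of_sqrt_le` (for `R ≥ ⌊√(n−h)⌋`, `Δ_h(n; R) = −[n − h = □]`, the
  printed remark in signed form) and `norm_delta_le_one_of_sqrt_le`; the counting of characters by
  conductor, `card_filter_conductor_le_sum` (`#{χ mod k : cond χ ≤ R} ≤ ∑_{d ∣ k, d ≤ R} φ(d)`),
  `card_filter_conductor_le` (`≤ R τ(k)`), `card_filter_conductor_le_totient` (`≤ φ(k)`);
  `norm_charSum_le`; and the trivial bound (2.2) "`τ̃_h(n; R) ≪_ε n^ε R^{1+ε}`" in the explicit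
  crude forms `norm_dtilde_le_sum`, `norm_dtilde_le_two_mul_sqrt` (`‖τ̃‖ ≤ 2⌊√(n−h)⌋`),
  `norm_dtilde_le_mul_sum` (`‖τ̃‖ ≤ 2R ∑_{q ≤ √(n−h)} τ(q/(h,q))/φ(q/(h,q))`) and
  `norm_dtilde_le_of_card_divisors_le` (`‖τ̃_h(n; R)‖ ≤ 2R|h|T²(1 + log ⌊√(n−h)⌋)` whenever
  `τ ≤ T` on `[1, √(n−h)]`; with the divisor bound `T = C_ε n^ε` this is (2.2) up to the harmless
  factor `|h|`), via `le_totient_mul_card_divisors` (`m ≤ φ(m)τ(m)`), `totient_inv_le`,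
  `harmonic_Icc_le`; the growth of the class, `divisorPow_succ_le` (`d_{A+1}(n) ≤ τ(n)^A`) and
  `norm_le_of_mem_classF` (`|f(n)| ≤ τ(n)^{A−1}` on `𝓕_D(A)`).

Not here (yet): the §8 deduction of Theorem 1.2 from Proposition 2.1 and Lemma 8.1 (design: a
proved reduction theorem with both as explicit hypotheses, Prop. 2.1 phrased through `sigmaF`,
Lemma 8.1 in the form used on p. 23 — conductor `≤ (log x)^B`, moduli and a coprimality parameter
`≤ x`); the discharge `thm12_conductorOne_holds` itself (blocked on the deep inputs listed above).

## References

* S. Drappeau, B. Topacogullari, *Combinatorial identities and Titchmarsh's divisor problem for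
  multiplicative functions*, Algebra Number Theory 13 (2019), no. 10, 2383–2425,
  doi:10.2140/ant.2019.13.2383, arXiv:1807.09569. [DrappeauTopacogullari2019]
-/

noncomputable section

open scoped ArithmeticFunction.zeta ArithmeticFunction.sigma ArithmeticFunction.Moebius
open ArithmeticFunction Finset Real

namespace Literature.NumberTheory.Sieve

namespace DrappeauTopacogullari2019

/-! ### Bricks of the printed proof: the divisor-pair symmetry of §2.1 -/

/-- **Divisor-pair symmetry** (the elementary identity behind the approximant `τ̃_h(n; R)` of
Drappeau–Topacogullari (2.1) and the remark following it, p. 9: "`τ̃_h(n; R) = τ(n − h)` if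
`R > √(n − h)` and `n − h` is not a perfect square"). For `m ≥ 1`, pairing each divisor `q` of `m`
with `m / q` gives `2 · #{q ∣ m : q² ≤ m} = τ(m) + #{q ∣ m : q² = m}` (the last set is `{√m}` or
empty). [cite: DrappeauTopacogullari2019, §2.1 (2.1) and remark, p. 9] -/
theorem two_mul_card_divisors_mul_self_le {m : ℕ} (hm : m ≠ 0) :
    2 * ((Nat.divisors m).filter (fun q => q * q ≤ m)).card =
      σ 0 m + ((Nat.divisors m).filter (fun q => q * q = m)).card := by
  set S := (Nat.divisors m).filter (fun q => q * q ≤ m) with hS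
  set L := (Nat.divisors m).filter (fun q => m ≤ q * q) with hL
  have hSL : S.card = L.card := by
    refine Finset.card_nbij' (fun q => m / q) (fun q => m / q) ?_ ?_ ?_ ?_
    · intro q hq
      simp only [hS, hL, Finset.mem_coe, Finset.mem_filter, Nat.mem_divisors] at hq ⊢
      obtain ⟨⟨⟨k, rfl⟩, -⟩, hqq⟩ := hq
      have hq0 : 0 < q := Nat.pos_of_ne_zero (fun h0 => hm (by simp [h0]))
      rw [Nat.mul_div_cancel_left k hq0]
      exact ⟨⟨Dvd.intro_left q rfl, hm⟩,
        Nat.mul_le_mul_right k (Nat.le_of_mul_le_mul_left hqq hq0)⟩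
    · intro q hq
      simp only [hS, hL, Finset.mem_coe, Finset.mem_filter, Nat.mem_divisors] at hq ⊢
      obtain ⟨⟨⟨k, rfl⟩, -⟩, hqq⟩ := hq
      have hq0 : 0 < q := Nat.pos_of_ne_zero (fun h0 => hm (by simp [h0]))
      rw [Nat.mul_div_cancel_left k hq0]
      refine ⟨⟨Dvd.intro_left q rfl, hm⟩, ?_⟩
      exact Nat.mul_le_mul_right k (Nat.le_of_mul_le_mul_left hqq hq0)
    · intro q hq
      simp only [hS, Finset.mem_coe, Finset.mem_filter, Nat.mem_divisors] at hq
      exact Nat.div_div_self hq.1.1 hm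
    · intro q hq
      simp only [hL, Finset.mem_coe, Finset.mem_filter, Nat.mem_divisors] at hq
      exact Nat.div_div_self hq.1.1 hm
  have hunion : S ∪ L = Nat.divisors m := by
    ext q
    simp only [hS, hL, Finset.mem_union, Finset.mem_filter]
    constructor
    · rintro (⟨h1, -⟩ | ⟨h1, -⟩) <;> exact h1
    · intro h1
      rcases le_total (q * q) m with h2 | h2
      · exact Or.inl ⟨h1, h2⟩
      · exact Or.inr ⟨h1, h2⟩
  have hinter : S ∩ L = (Nat.divisors m).filter (fun q => q * q = m) := by
    ext q
    simp only [hS, hL, Finset.mem_inter, Finset.mem_filter]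
    constructor
    · rintro ⟨⟨h1, h2⟩, ⟨-, h3⟩⟩
      exact ⟨h1, le_antisymm h2 h3⟩
    · rintro ⟨h1, h2⟩
      exact ⟨⟨h1, h2.le⟩, ⟨h1, h2.ge⟩⟩
  have hcard := Finset.card_union_add_card_inter S L
  rw [hunion, hinter, ← sigma_zero_apply, ← hSL] at hcard
  omega

/-- The correction term of `two_mul_card_divisors_mul_self_le` is the indicator of nonzero perfect
squares: `#{q ∣ m : q² = m} = [m ≠ 0 is a square]`. [folklore] -/
theorem card_divisors_filter_mul_self_eq (m : ℕ) :
    ((Nat.divisors m).filter (fun q => q * q = m)).card = if IsSquare m ∧ m ≠ 0 then 1 else 0 := by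
  split_ifs with hsq
  · obtain ⟨⟨r, hr⟩, hm⟩ := hsq
    rw [Finset.card_eq_one]
    refine ⟨r, ?_⟩
    ext q
    simp only [Finset.mem_filter, Nat.mem_divisors, Finset.mem_singleton]
    constructor
    · rintro ⟨-, hq⟩
      exact Nat.mul_self_inj.mp (hq.trans hr)
    · rintro rfl
      exact ⟨⟨Dvd.intro _ hr.symm, hm⟩, hr.symm⟩
  · rw [Finset.card_eq_zero, Finset.filter_eq_empty_iff]
    intro q hq hqm
    exact hsq ⟨⟨q, hqm.symm⟩, (Nat.mem_divisors.mp hq).2⟩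

/-- **The opening move of the dispersion method for `S_f(x; h, a)`** (Drappeau–Topacogullari §2.1,
p. 9, the case of complete character sums in (2.1)): writing `τ(an − h)` through divisor pairs,
`∑_{|h|/a < n ≤ x} f(n) τ(an − h) = 2 ∑_{|h|/a < n ≤ x} f(n) · #{q ∣ an − h : q² ≤ an − h}
  − ∑_{|h|/a < n ≤ x} f(n) · #{q : q² = an − h}`,
the last sum being supported on the `n` with `an − h` a perfect square.
[cite: DrappeauTopacogullari2019, §2.1 (2.1) and remark, p. 9] -/
theorem shiftedSum_eq_divisorPairs (f : ArithmeticFunction ℂ) (x : ℝ) (h : ℤ) (a : ℕ) :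
    shiftedSum f x h a =
      2 * ∑ n ∈ (Finset.Icc 1 ⌊x⌋₊).filter (fun n : ℕ => h.natAbs < a * n),
          f n * (((Nat.divisors (Int.toNat ((a : ℤ) * n - h))).filter
            (fun q => q * q ≤ Int.toNat ((a : ℤ) * n - h))).card : ℂ)
        - ∑ n ∈ (Finset.Icc 1 ⌊x⌋₊).filter (fun n : ℕ => h.natAbs < a * n),
          f n * (((Nat.divisors (Int.toNat ((a : ℤ) * n - h))).filter
            (fun q => q * q = Int.toNat ((a : ℤ) * n - h))).card : ℂ) := by
  rw [shiftedSum, Finset.mul_sum, ← Finset.sum_sub_distrib]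
  refine Finset.sum_congr rfl fun n hn => ?_
  have hn' := (Finset.mem_filter.mp hn).2
  set m : ℕ := Int.toNat ((a : ℤ) * n - h) with hm
  have hm0 : m ≠ 0 := by
    have : (0 : ℤ) < (a : ℤ) * n - h := by
      have h1 : (h.natAbs : ℤ) < (a : ℤ) * n := by exact_mod_cast hn'
      have h2 : h ≤ (h.natAbs : ℤ) := Int.le_natAbs
      omega
    rw [hm]
    omega
  have key := two_mul_card_divisors_mul_self_le hm0
  have keyC : (σ 0 m : ℂ) =
      2 * (((Nat.divisors m).filter (fun q => q * q ≤ m)).card : ℂ)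
        - (((Nat.divisors m).filter (fun q => q * q = m)).card : ℂ) := by
    have := congrArg (fun t : ℕ => (t : ℂ)) key
    simp only [Nat.cast_mul, Nat.cast_add, Nat.cast_ofNat] at this
    exact eq_sub_iff_add_eq.mpr this.symm
  rw [keyC]
  ring

/-! ### Consumer corollaries of Theorem 1.2 at conductor one -/

/-- **Theorem 1.2 (`D = 1`) for the Liouville function** (`λ ∈ 𝓕₁(1)`, `liouville_mem_classF`):
for every `N ≥ 1` there are `δ > 0` and `C` with
`|∑_{|h|/a < n ≤ x} λ(n) τ(an − h) − M_λ(x; h, a)| ≤ C τ((a, h)) x/(log x)^N` for `x ≥ 2`,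
`1 ≤ a ≤ x^δ`, `1 ≤ |h| ≤ x^δ` — the `R = 1` input of the Parity consumer, conditional on the named
fact `thm12_conductorOne`. [cite: DrappeauTopacogullari2019, Theorem 1.2] -/
theorem thm12_conductorOne.liouville (hT : thm12_conductorOne) (N : ℕ) (hN : 1 ≤ N) :
    ∃ δ : ℝ, 0 < δ ∧ ∃ C : ℝ, ∀ x : ℝ, 2 ≤ x →
      ∀ (a : ℕ) (h : ℤ), 1 ≤ a → (a : ℝ) ≤ x ^ δ → h ≠ 0 → (|h| : ℝ) ≤ x ^ δ →
        ‖shiftedSum ((liouville : ArithmeticFunction ℤ) : ArithmeticFunction ℂ) x h a -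
            mainTermOne ((liouville : ArithmeticFunction ℤ) : ArithmeticFunction ℂ) x h a‖ ≤
          C * (σ 0 (Nat.gcd a h.natAbs) : ℝ) * x / Real.log x ^ N := by
  obtain ⟨δ, hδ, C, hC⟩ := hT 1 N le_rfl hN
  exact ⟨δ, hδ, C, fun x hx a h ha hax hh hhx => hC _ liouville_mem_classF x hx a h ha hax hh hhx⟩

/-- **Theorem 1.2 (`D = 1`) for the Möbius function** (`μ = d_{−1} ∈ 𝓕₁(1)`,
`moebius_mem_classF`): for every `N ≥ 1` there are `δ > 0` and `C` with
`|∑_{|h|/a < n ≤ x} μ(n) τ(an − h) − M_μ(x; h, a)| ≤ C τ((a, h)) x/(log x)^N` for `x ≥ 2`,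
`1 ≤ a ≤ x^δ`, `1 ≤ |h| ≤ x^δ`, conditional on the named fact `thm12_conductorOne` (compare
Theorem 1.3 at `z = −1`, `thm13_moebius`, where the main term is absorbed).
[cite: DrappeauTopacogullari2019, Theorem 1.2] -/
theorem thm12_conductorOne.moebius (hT : thm12_conductorOne) (N : ℕ) (hN : 1 ≤ N) :
    ∃ δ : ℝ, 0 < δ ∧ ∃ C : ℝ, ∀ x : ℝ, 2 ≤ x →
      ∀ (a : ℕ) (h : ℤ), 1 ≤ a → (a : ℝ) ≤ x ^ δ → h ≠ 0 → (|h| : ℝ) ≤ x ^ δ →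
        ‖shiftedSum ((μ : ArithmeticFunction ℤ) : ArithmeticFunction ℂ) x h a -
            mainTermOne ((μ : ArithmeticFunction ℤ) : ArithmeticFunction ℂ) x h a‖ ≤
          C * (σ 0 (Nat.gcd a h.natAbs) : ℝ) * x / Real.log x ^ N := by
  obtain ⟨δ, hδ, C, hC⟩ := hT 1 N le_rfl hN
  exact ⟨δ, hδ, C, fun x hx a h ha hax hh hhx => hC _ moebius_mem_classF x hx a h ha hax hh hhx⟩

/-! ### §2.1 continued: `Δ_h` for complete character sums, counting characters, the bound (2.2) -/

/-- **The remark after (2.1), p. 9, in signed form**: if `R ≥ ⌊√(n − h)⌋` then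
`Δ_h(n; R) = τ(n − h) − τ̃_h(n; R) = −#{q : q² = n − h}`, i.e. `0` unless `n − h` is a perfect
square, when it is `−1` ("`τ̃_h(n; R) = τ(n − h)` if `R > √(n − h)` and `n − h` is not a perfect
square"). From `dtilde_eq_two_mul_card` and `two_mul_card_divisors_mul_self_le`.
[cite: DrappeauTopacogullari2019, §2.1 remark after (2.1), p. 9] -/
theorem delta_eq_neg_card_of_sqrt_le {h : ℤ} {n : ℕ} {R : ℝ}
    (hR : (Nat.sqrt (Int.toNat ((n : ℤ) - h)) : ℝ) ≤ R) :
    delta h n R = -(((Nat.divisors (Int.toNat ((n : ℤ) - h))).filter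
          (fun q => q * q = Int.toNat ((n : ℤ) - h))).card : ℂ) := by
  rw [delta, dtilde_eq_two_mul_card hR]
  rcases eq_or_ne (Int.toNat ((n : ℤ) - h)) 0 with hm0 | hm0
  · rw [hm0]; simp
  · have key := congrArg (fun t : ℕ => (t : ℂ)) (two_mul_card_divisors_mul_self_le hm0)
    simp only [Nat.cast_mul, Nat.cast_add, Nat.cast_ofNat] at key
    rw [key]
    ring

/-- For `R ≥ ⌊√(n − h)⌋`, `|Δ_h(n; R)| ≤ 1`. [cite: DrappeauTopacogullari2019, §2.1 remark after (2.1), p. 9] -/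
theorem norm_delta_le_one_of_sqrt_le {h : ℤ} {n : ℕ} {R : ℝ}
    (hR : (Nat.sqrt (Int.toNat ((n : ℤ) - h)) : ℝ) ≤ R) : ‖delta h n R‖ ≤ 1 := by
  rw [delta_eq_neg_card_of_sqrt_le hR, norm_neg, Complex.norm_natCast,
    card_divisors_filter_mul_self_eq]
  split_ifs <;> simp

/-- **Counting characters by conductor**: for `k ≥ 1`, the characters mod `k` of conductor `≤ R`
number at most `∑_{d ∣ k, d ≤ R} φ(d)` (a character of conductor `d` is the lift of one of the
`φ(d)` characters mod `d`). [folklore] -/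
theorem card_filter_conductor_le_sum {k : ℕ} (hk : 0 < k) (R : ℝ) :
    ((Finset.univ : Finset (DirichletCharacter ℂ k)).filter
        (fun χ => (χ.conductor : ℝ) ≤ R)).card
      ≤ ∑ d ∈ (Nat.divisors k).filter (fun d : ℕ => (d : ℝ) ≤ R), Nat.totient d := by
  classical
  haveI : NeZero k := ⟨hk.ne'⟩
  have hmap : Set.MapsTo (fun χ : DirichletCharacter ℂ k => χ.conductor)
      ((Finset.univ : Finset (DirichletCharacter ℂ k)).filter
        (fun χ => (χ.conductor : ℝ) ≤ R) : Set (DirichletCharacter ℂ k))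
      ((Nat.divisors k).filter (fun d : ℕ => (d : ℝ) ≤ R) : Set ℕ) := by
    intro χ hχ
    simp only [Finset.coe_filter, Finset.mem_univ, true_and, Set.mem_setOf_eq] at hχ ⊢
    exact ⟨Nat.mem_divisors.mpr ⟨χ.conductor_dvd_level, hk.ne'⟩, hχ⟩
  rw [Finset.card_eq_sum_card_fiberwise hmap]
  refine Finset.sum_le_sum fun d hd => ?_
  have hdk : d ∣ k := Nat.dvd_of_mem_divisors (Finset.mem_filter.mp hd).1
  have hd0 : 0 < d := Nat.pos_of_mem_divisors (Finset.mem_filter.mp hd).1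
  haveI : NeZero d := ⟨hd0.ne'⟩
  haveI : NeZero ((Monoid.exponent (ZMod d)ˣ : ℕ) : ℂ) :=
    ⟨Nat.cast_ne_zero.mpr Monoid.exponent_ne_zero_of_finite⟩
  calc (((Finset.univ : Finset (DirichletCharacter ℂ k)).filter
          (fun χ => (χ.conductor : ℝ) ≤ R)).filter (fun χ => χ.conductor = d)).card
      ≤ ((Finset.univ : Finset (DirichletCharacter ℂ d)).image
          (DirichletCharacter.changeLevel hdk)).card := by
        refine Finset.card_le_card fun χ hχ => ?_
        simp only [Finset.mem_filter, Finset.mem_univ, true_and] at hχ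
        have hft : χ.FactorsThrough d :=
          (χ.mem_conductorSet_iff_conductor_dvd hdk).mpr (hχ.2 ▸ dvd_refl _)
        obtain ⟨_, χ₀, hχ₀⟩ := hft
        exact Finset.mem_image.mpr ⟨χ₀, Finset.mem_univ _, hχ₀.symm⟩
    _ ≤ (Finset.univ : Finset (DirichletCharacter ℂ d)).card := Finset.card_image_le
    _ = Nat.totient d := by
        rw [Finset.card_univ, ← Nat.card_eq_fintype_card]
        exact DirichletCharacter.card_eq_totient_of_hasEnoughRootsOfUnity ℂ d

/-- `#{χ mod k : cond χ ≤ R} ≤ R · τ(k)` for `k ≥ 1`, `R ≥ 0` (from `φ(d) ≤ d ≤ R`); the count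
behind the factor `R^{1+ε}` in (2.2). [folklore] -/
theorem card_filter_conductor_le {k : ℕ} (hk : 0 < k) {R : ℝ} (hR : 0 ≤ R) :
    (((Finset.univ : Finset (DirichletCharacter ℂ k)).filter
        (fun χ => (χ.conductor : ℝ) ≤ R)).card : ℝ) ≤ R * (Nat.divisors k).card := by
  have h1 := card_filter_conductor_le_sum hk R
  have h2 : ((∑ d ∈ (Nat.divisors k).filter (fun d : ℕ => (d : ℝ) ≤ R), Nat.totient d : ℕ) : ℝ)
      ≤ ∑ d ∈ (Nat.divisors k).filter (fun d : ℕ => (d : ℝ) ≤ R), R := by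
    push_cast
    refine Finset.sum_le_sum fun d hd => ?_
    have hdR := (Finset.mem_filter.mp hd).2
    exact le_trans (by exact_mod_cast Nat.totient_le d) hdR
  calc _ ≤ ((∑ d ∈ (Nat.divisors k).filter (fun d : ℕ => (d : ℝ) ≤ R), Nat.totient d : ℕ) : ℝ) := by
        exact_mod_cast h1
    _ ≤ ∑ d ∈ (Nat.divisors k).filter (fun d : ℕ => (d : ℝ) ≤ R), R := h2
    _ = R * ((Nat.divisors k).filter (fun d : ℕ => (d : ℝ) ≤ R)).card := by
        rw [Finset.sum_const, nsmul_eq_mul, mul_comm]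
    _ ≤ R * (Nat.divisors k).card := by
        gcongr
        exact Finset.filter_subset _ _

/-- `#{χ mod k : cond χ ≤ R} ≤ φ(k)` (all characters mod `k`). [folklore] -/
theorem card_filter_conductor_le_totient {k : ℕ} (hk : 0 < k) (R : ℝ) :
    ((Finset.univ : Finset (DirichletCharacter ℂ k)).filter
        (fun χ => (χ.conductor : ℝ) ≤ R)).card ≤ Nat.totient k := by
  haveI : NeZero k := ⟨hk.ne'⟩
  haveI : NeZero ((Monoid.exponent (ZMod k)ˣ : ℕ) : ℂ) :=
    ⟨Nat.cast_ne_zero.mpr Monoid.exponent_ne_zero_of_finite⟩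
  calc _ ≤ (Finset.univ : Finset (DirichletCharacter ℂ k)).card := Finset.card_filter_le _ _
    _ = Nat.totient k := by
        rw [Finset.card_univ, ← Nat.card_eq_fintype_card]
        exact DirichletCharacter.card_eq_totient_of_hasEnoughRootsOfUnity ℂ k

/-- The character sum in (2.1) is bounded by the number of characters entering it
(`|χ(a⁻¹) χ(b)| ≤ 1`). [folklore] -/
theorem norm_charSum_le {k : ℕ} (R : ℝ) (a b : ZMod k) :
    ‖∑ χ ∈ (Finset.univ : Finset (DirichletCharacter ℂ k)).filter
          (fun χ => (χ.conductor : ℝ) ≤ R), χ a⁻¹ * χ b‖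
      ≤ ((Finset.univ : Finset (DirichletCharacter ℂ k)).filter
          (fun χ => (χ.conductor : ℝ) ≤ R)).card := by
  refine (norm_sum_le _ _).trans ?_
  have : ∀ χ ∈ (Finset.univ : Finset (DirichletCharacter ℂ k)).filter
      (fun χ => (χ.conductor : ℝ) ≤ R), ‖χ a⁻¹ * χ b‖ ≤ 1 := by
    intro χ _
    rw [norm_mul]
    exact mul_le_one₀ (χ.norm_le_one _) (norm_nonneg _) (χ.norm_le_one _)
  refine (Finset.sum_le_sum this).trans ?_
  simp

/-- **Towards (2.2)**: `‖τ̃_h(n; R)‖ ≤ 2 ∑_{q ≤ √(n−h)} φ(q/(h,q))⁻¹ · #{χ mod q/(h,q) : cond χ ≤ R}`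
(drop the constraint `(n, q) = (h, q)` and bound each character value by `1`).
[cite: DrappeauTopacogullari2019, §2.1 (2.2), p. 9] -/
theorem norm_dtilde_le_sum (h : ℤ) (n : ℕ) (R : ℝ) :
    ‖dtilde h n R‖ ≤ 2 * ∑ q ∈ Finset.Icc 1 (Nat.sqrt (Int.toNat ((n : ℤ) - h))),
      ((Nat.totient (q / Nat.gcd h.natAbs q) : ℝ)⁻¹ *
        ((Finset.univ : Finset (DirichletCharacter ℂ (q / Nat.gcd h.natAbs q))).filter
          (fun χ => (χ.conductor : ℝ) ≤ R)).card) := by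
  unfold dtilde
  rw [norm_mul, Complex.norm_two]
  refine mul_le_mul_of_nonneg_left ?_ (by norm_num)
  refine (norm_sum_le _ _).trans ?_
  refine le_trans (Finset.sum_le_sum_of_subset_of_nonneg (Finset.filter_subset _ _)
    (fun q _ _ => norm_nonneg _)) ?_
  refine Finset.sum_le_sum fun q hq => ?_
  rw [norm_mul, norm_inv, Complex.norm_natCast]
  refine mul_le_mul_of_nonneg_left (norm_charSum_le _ _ _) (inv_nonneg.mpr (Nat.cast_nonneg _))

/-- `‖τ̃_h(n; R)‖ ≤ 2⌊√(n − h)⌋` (at most `φ(k)` characters mod `k`).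
[cite: DrappeauTopacogullari2019, §2.1 (2.2), p. 9] -/
theorem norm_dtilde_le_two_mul_sqrt (h : ℤ) (n : ℕ) (R : ℝ) :
    ‖dtilde h n R‖ ≤ 2 * Nat.sqrt (Int.toNat ((n : ℤ) - h)) := by
  refine (norm_dtilde_le_sum h n R).trans ?_
  refine mul_le_mul_of_nonneg_left ?_ (by norm_num)
  have : ∀ q ∈ Finset.Icc 1 (Nat.sqrt (Int.toNat ((n : ℤ) - h))),
      ((Nat.totient (q / Nat.gcd h.natAbs q) : ℝ)⁻¹ *
        ((Finset.univ : Finset (DirichletCharacter ℂ (q / Nat.gcd h.natAbs q))).filter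
          (fun χ => (χ.conductor : ℝ) ≤ R)).card) ≤ 1 := by
    intro q hq
    have hq1 : 1 ≤ q := (Finset.mem_Icc.mp hq).1
    have hd0 : 0 < Nat.gcd h.natAbs q := Nat.gcd_pos_of_pos_right _ hq1
    have hk : 0 < q / Nat.gcd h.natAbs q :=
      Nat.div_pos (Nat.le_of_dvd hq1 (Nat.gcd_dvd_right _ _)) hd0
    have hφ : (0 : ℝ) < Nat.totient (q / Nat.gcd h.natAbs q) := by
      exact_mod_cast Nat.totient_pos.mpr hk
    rw [inv_mul_le_iff₀ hφ, mul_one]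
    exact_mod_cast card_filter_conductor_le_totient hk R
  refine (Finset.sum_le_sum this).trans ?_
  simp

/-- `‖τ̃_h(n; R)‖ ≤ 2R ∑_{q ≤ √(n−h)} τ(q/(h,q)) / φ(q/(h,q))` for `R ≥ 0` (at most `R τ(k)`
characters mod `k` of conductor `≤ R`). [cite: DrappeauTopacogullari2019, §2.1 (2.2), p. 9] -/
theorem norm_dtilde_le_mul_sum (h : ℤ) (n : ℕ) {R : ℝ} (hR : 0 ≤ R) :
    ‖dtilde h n R‖ ≤ 2 * R * ∑ q ∈ Finset.Icc 1 (Nat.sqrt (Int.toNat ((n : ℤ) - h))),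
      ((Nat.totient (q / Nat.gcd h.natAbs q) : ℝ)⁻¹ *
        (Nat.divisors (q / Nat.gcd h.natAbs q)).card) := by
  refine (norm_dtilde_le_sum h n R).trans ?_
  rw [mul_assoc]
  refine mul_le_mul_of_nonneg_left ?_ (by norm_num : (0 : ℝ) ≤ 2)
  rw [Finset.mul_sum]
  refine Finset.sum_le_sum fun q hq => ?_
  have hq1 : 1 ≤ q := (Finset.mem_Icc.mp hq).1
  have hd0 : 0 < Nat.gcd h.natAbs q := Nat.gcd_pos_of_pos_right _ hq1
  have hk : 0 < q / Nat.gcd h.natAbs q :=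
    Nat.div_pos (Nat.le_of_dvd hq1 (Nat.gcd_dvd_right _ _)) hd0
  rw [mul_left_comm]
  exact mul_le_mul_of_nonneg_left (card_filter_conductor_le hk hR)
    (inv_nonneg.mpr (Nat.cast_nonneg _))

/-- `m ≤ φ(m) τ(m)` (multiplicativity; for a prime power `p^n ≤ p^{n−1}(p − 1)(n + 1)`); the same
statement as `Literature.NumberTheory.Sieve.self_le_totient_mul_card_divisors`
(`BombieriVinogradovReduction`), re-proved (privately) to keep this file's imports light. [folklore] -/
private theorem le_totient_mul_card_divisors (m : ℕ) : m ≤ Nat.totient m * m.divisors.card := by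
  induction m using Nat.recOnPosPrimePosCoprime with
  | prime_pow p n hp hn =>
    rw [Nat.totient_prime_pow hp hn, ← ArithmeticFunction.sigma_zero_apply,
      ArithmeticFunction.sigma_zero_apply_prime_pow hp]
    have hp2 := hp.two_le
    calc p ^ n = p ^ (n - 1) * p := by rw [← pow_succ, Nat.sub_add_cancel hn]
      _ ≤ p ^ (n - 1) * ((p - 1) * (n + 1)) := by
        refine Nat.mul_le_mul_left _ ?_
        calc p ≤ (p - 1) * 2 := by omega
          _ ≤ (p - 1) * (n + 1) := Nat.mul_le_mul_left _ (by omega)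
      _ = _ := by ring
  | zero => exact Nat.zero_le _
  | one => simp
  | coprime a b ha hb hab iha ihb =>
    rw [Nat.totient_mul hab, Nat.Coprime.card_divisors_mul hab]
    calc a * b ≤ (Nat.totient a * a.divisors.card) * (Nat.totient b * b.divisors.card) :=
        Nat.mul_le_mul iha ihb
      _ = _ := by ring

/-- `φ(m)⁻¹ ≤ τ(m)/m` for `m ≥ 1`. [folklore] -/
theorem totient_inv_le (m : ℕ) (hm : 0 < m) :
    ((Nat.totient m : ℝ))⁻¹ ≤ (m.divisors.card : ℝ) / m := by
  have hφ : (0 : ℝ) < Nat.totient m := by exact_mod_cast Nat.totient_pos.mpr hm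
  have hm' : (0 : ℝ) < m := by exact_mod_cast hm
  rw [inv_le_iff_one_le_mul₀ hφ, div_mul_eq_mul_div, one_le_div hm']
  exact_mod_cast (le_totient_mul_card_divisors m).trans_eq (mul_comm _ _)

/-- **Growth of the majorant of `𝓕_D(A)`**: `d_{A+1}(n) ≤ τ(n)^A` (induction on `A`:
`d_{A+2}(n) = ∑_{m ∣ n} d_{A+1}(m) ≤ τ(n) · τ(n)^A`). [folklore] -/
theorem divisorPow_succ_le (A n : ℕ) : divisorPow (A + 1) n ≤ n.divisors.card ^ A := by
  induction A generalizing n with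
  | zero =>
    rcases eq_or_ne n 0 with rfl | hn
    · simp [divisorPow]
    · rw [zero_add, divisorPow_one_apply hn, pow_zero]
  | succ A ih =>
    rw [divisorPow, pow_succ, ArithmeticFunction.mul_zeta_apply]
    calc ∑ i ∈ n.divisors, (ζ ^ (A + 1)) i ≤ ∑ i ∈ n.divisors, n.divisors.card ^ A := by
          refine Finset.sum_le_sum fun i hi => ?_
          refine (ih i).trans ?_
          exact Nat.pow_le_pow_left (Finset.card_le_card
            (Nat.divisors_subset_of_dvd (Nat.mem_divisors.mp hi).2 (Nat.dvd_of_mem_divisors hi))) A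
      _ = n.divisors.card ^ (A + 1) := by
          rw [Finset.sum_const, smul_eq_mul, pow_succ, mul_comm]

/-- For `f ∈ 𝓕_D(A)` (`A ≥ 1`), `|f(n)| ≤ d_A(n) ≤ τ(n)^{A−1}`; with the divisor bound this is the
pointwise bound `f(n) ≪_ε n^ε` used throughout §8.
[cite: DrappeauTopacogullari2019, §1 (definition of 𝓕_D(A), p. 3)] -/
theorem norm_le_of_mem_classF {D A : ℕ} {f : ArithmeticFunction ℂ} (hf : f ∈ classF D A)
    (hA : 1 ≤ A) (n : ℕ) : ‖f n‖ ≤ (n.divisors.card : ℝ) ^ (A - 1) := by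
  refine (hf.2.2 n).trans ?_
  obtain ⟨B, rfl⟩ : ∃ B, A = B + 1 := ⟨A - 1, (Nat.sub_add_cancel hA).symm⟩
  rw [Nat.add_sub_cancel]
  exact_mod_cast divisorPow_succ_le B n

/-- `∑_{q ≤ Q} 1/q ≤ 1 + log Q` (Mathlib's `harmonic_le_one_add_log`; private copy of
`Literature.NumberTheory.Sieve.harmonic_Icc_le` of `BombieriVinogradovReduction`). [folklore] -/
private theorem harmonic_Icc_le (Q : ℕ) : ∑ q ∈ Finset.Icc 1 Q, ((q : ℝ))⁻¹ ≤ 1 + Real.log Q := by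
  have := harmonic_le_one_add_log Q
  rw [harmonic_eq_sum_Icc] at this
  push_cast at this
  exact this

/-- **The trivial bound (2.2)** ("`τ̃_h(n; R) ≪_ε n^ε R^{1+ε}`", p. 9) in a crude explicit form
sufficient for §8: if `τ(q) ≤ T` for all `q ≤ √(n − h)` and `h ≠ 0`, then
`‖τ̃_h(n; R)‖ ≤ 2R · |h| T² (1 + log ⌊√(n − h)⌋)` — from `norm_dtilde_le_mul_sum`,
`φ(k)⁻¹ ≤ τ(k)/k`, `τ(q/(h,q)) ≤ τ(q) ≤ T`, `(h,q) ≤ |h|` and the harmonic bound. (With the divisor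
bound `T = C_ε n^ε`; the factor `|h| ≤ x^δ` is harmless in §8.)
[cite: DrappeauTopacogullari2019, §2.1 (2.2), p. 9] -/
theorem norm_dtilde_le_of_card_divisors_le {h : ℤ} (hh : h ≠ 0) (n : ℕ) {R T : ℝ} (hR : 0 ≤ R)
    (hT : ∀ q ∈ Finset.Icc 1 (Nat.sqrt (Int.toNat ((n : ℤ) - h))), ((Nat.divisors q).card : ℝ) ≤ T) :
    ‖dtilde h n R‖ ≤ 2 * R * (|(h : ℝ)| * T ^ 2 *
      (1 + Real.log (Nat.sqrt (Int.toNat ((n : ℤ) - h))))) := by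
  set Q := Nat.sqrt (Int.toNat ((n : ℤ) - h)) with hQ
  refine (norm_dtilde_le_mul_sum h n hR).trans ?_
  refine mul_le_mul_of_nonneg_left ?_ (by positivity)
  have hhpos : 0 < h.natAbs := Int.natAbs_pos.mpr hh
  have habs : ((h.natAbs : ℕ) : ℝ) = |(h : ℝ)| := by
    rw [Nat.cast_natAbs, Int.cast_abs]
  have key : ∀ q ∈ Finset.Icc 1 Q,
      ((Nat.totient (q / Nat.gcd h.natAbs q) : ℝ))⁻¹ *
        ((Nat.divisors (q / Nat.gcd h.natAbs q)).card : ℝ) ≤ |(h : ℝ)| * T ^ 2 * ((q : ℝ))⁻¹ := by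
    intro q hq
    have hq1 : 1 ≤ q := (Finset.mem_Icc.mp hq).1
    have hq0 : (0 : ℝ) < q := by exact_mod_cast hq1
    set d := Nat.gcd h.natAbs q with hd
    have hd0 : 0 < d := Nat.gcd_pos_of_pos_right _ hq1
    have hdq : d ∣ q := Nat.gcd_dvd_right _ _
    have hdh : d ≤ h.natAbs := Nat.gcd_le_left _ hhpos
    set k := q / d with hk
    have hk0 : 0 < k := Nat.div_pos (Nat.le_of_dvd hq1 hdq) hd0
    have hkq : k ∣ q := Nat.div_dvd_of_dvd hdq
    -- τ(k) ≤ τ(q) ≤ T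
    have hτk : ((Nat.divisors k).card : ℝ) ≤ T := by
      refine le_trans ?_ (hT q hq)
      exact_mod_cast Finset.card_le_card (Nat.divisors_subset_of_dvd (by omega) hkq)
    have hτk0 : (0 : ℝ) ≤ (Nat.divisors k).card := Nat.cast_nonneg _
    have hT0 : 0 ≤ T := hτk0.trans hτk
    -- 1/k = d/q ≤ |h|/q
    have hkinv : ((k : ℝ))⁻¹ ≤ |(h : ℝ)| * ((q : ℝ))⁻¹ := by
      have hkd : (k : ℝ) * d = q := by
        rw [hk]; exact_mod_cast Nat.div_mul_cancel hdq
      have hd0' : (0 : ℝ) < d := by exact_mod_cast hd0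
      have h1 : (1 : ℝ) ≤ |(h : ℝ)| * ((d : ℝ))⁻¹ := by
        rw [← div_eq_mul_inv, one_le_div hd0', ← habs]; exact_mod_cast hdh
      rw [← hkd]
      calc ((k : ℝ))⁻¹ = 1 * ((k : ℝ))⁻¹ := (one_mul _).symm
        _ ≤ (|(h : ℝ)| * ((d : ℝ))⁻¹) * ((k : ℝ))⁻¹ :=
            mul_le_mul_of_nonneg_right h1 (by positivity)
        _ = |(h : ℝ)| * ((k : ℝ) * (d : ℝ))⁻¹ := by rw [mul_inv]; ring
    calc ((Nat.totient k : ℝ))⁻¹ * ((Nat.divisors k).card : ℝ)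
        ≤ (((Nat.divisors k).card : ℝ) / k) * (Nat.divisors k).card :=
          mul_le_mul_of_nonneg_right (totient_inv_le k hk0) hτk0
      _ = ((Nat.divisors k).card : ℝ) ^ 2 * ((k : ℝ))⁻¹ := by ring
      _ ≤ T ^ 2 * (|(h : ℝ)| * ((q : ℝ))⁻¹) := by
          refine mul_le_mul (pow_le_pow_left₀ hτk0 hτk 2) hkinv (by positivity) (by positivity)
      _ = |(h : ℝ)| * T ^ 2 * ((q : ℝ))⁻¹ := by ring
  refine (Finset.sum_le_sum key).trans ?_
  rw [← Finset.mul_sum]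
  refine mul_le_mul_of_nonneg_left (harmonic_Icc_le Q) (by positivity)

end DrappeauTopacogullari2019

end Literature.NumberTheory.Sieve

end
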